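import Summits.Ventures.Crystal3D.Theorems.StickyWulffConstantGenericWallFloorHStarSingle
import Summits.Ventures.Crystal3D.Theorems.StickyWulffConstantGenericWallFloorStackLedgerLocalTools
import Summits.Ventures.Crystal3D.Theorems.StickyWulffConstantGenericWallFloorTwinFrame
import Summits.Ventures.Crystal3D.Theorems.StickyWulffConstantGenericWallFloorCapStartBarlow
import Summits.Ventures.Crystal3D.Theorems.StickyWulffConstantGenericWallFloorSlotFrameIdentity
import Summits.Ventures.Crystal3D.Theorems.StickyWulffConstantGenericWallFloorCredits
import HarnessLib

/-!
# TWIN BOTTOMS CLASH: the bottom states `⟨A, u, 0⟩` and `⟨twinFrame A (A e₃), u, 0⟩` of the two row grains of one plate are never both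
# strongly certified at one ball (crux `GenericWallFloor`, stmt-Ventures-19480, kernel G; LAYER ROWS R1 step (iii-a), cf-p1 (ccxi)/(ccxiii), finding (BB))

HONEST FRAMING. Venture `Summits/Ventures/Crystal3D` (cell `crystal3d-full`), route `route-Ventures-StickyWulffConstant`, helper for the crux
`GenericWallFloor` (stmt-Ventures-19480) / consumer `TextureLiminfV5` (stmt-Ventures-23912).  Kissing-number bookkeeping on landed pieces
(`card_filter_dist_eq_one_le_twelve`, `card_far_slots_eq_three`, `basalMirror_not_mem_fccSlots`, `inner_slots_mem`, `twinFrame_axis_apply`); no inputs; F-C1 not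
moved; NOT R1.

THE POINT.  `bottoms_of_coaxial_twinGrains` (`…RowTwinGrainsApart`) leaves exactly one co-axial cross pair of the two row grains of a plate: the two
BOTTOM states, frames `A` and `G = twinFrame A (A e₃)` (`G x = A (basalMirror x)`), common direction `A u = G u` (`u` in-plane).  At a common ball
`y` both would certify the SAME predecessor `p = y − A u`: `WalkCertified12` makes `p` either `A`-full (its twelve `A`-slots occupied) or an exact
`A`-cap (nine `n₀`-non-negative `A`-slots and the three lowered positive ones occupied) — twelve contacts of `p` at known places — and likewise for
`G`.  But a `G`-certificate always puts a ball at some `p + G t = p + A (basalMirror t)` with `t` an out-of-plane slot, which is neither an `A`-slot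
point (`basalMirror t ∉ fccSlots`) nor a lowered `A`-slot (pairing with the in-plane `u`: `⟪t, u⟫ = ⟪w, u⟫ − 4/3` is not a slot angle): a
thirteenth contact of `p`, against the kissing bound.
* `norm_sub_capShift`, `certified12_contacts` (the twelve known contacts of the predecessor as a `12`-element finset of the
  contact set, each an `A`-slot point or a lowered positive `A`-slot), `exists_outOfPlane_contact` (a `G`-certificate yields an out-of-plane `G`-slot
  contact); **`not_both_certified12_twinBottoms`**.
WHAT THIS IS NOT: not the count; F-C1 not moved.
-/

noncomputable section

namespace Summit.Ventures.Crystal3D.Theorems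

open Finset
open Literature.MathematicalPhysics.StatisticalMechanics (fccStacking barlowPos constHagg barlowPos_apply_two basalMirror
  basalMirror_apply_coord)
open scoped InnerProductSpace

variable {X : Finset (EuclideanSpace ℝ (Fin 3))}

/-! ### Small facts -/

/-- The lowered positive slot is a unit vector: `‖F w − 2√(2/3)·n₀‖ = 1` when `⟪F w, n₀⟫ = √(2/3)`, `‖n₀‖ = 1`, `w` a slot. -/
theorem norm_sub_capShift (F : EuclideanSpace ℝ (Fin 3) ≃ₗᵢ[ℝ] EuclideanSpace ℝ (Fin 3)) {w n₀ : EuclideanSpace ℝ (Fin 3)}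
    (hw : w ∈ fccSlots) (hn : ‖n₀‖ = 1) (hwn : ⟪F w, n₀⟫_ℝ = Real.sqrt (2 / 3)) :
    ‖F w - (2 * Real.sqrt (2 / 3)) • n₀‖ = 1 := by
  have h23 : Real.sqrt (2 / 3) * Real.sqrt (2 / 3) = 2 / 3 := Real.mul_self_sqrt (by norm_num)
  have hFw : ‖F w‖ = 1 := by rw [LinearIsometryEquiv.norm_map, norm_eq_one_of_mem_fccSlots hw]
  have hsq : ‖F w - (2 * Real.sqrt (2 / 3)) • n₀‖ ^ 2 = 1 := by
    rw [@norm_sub_sq_real, hFw, norm_smul, hn, mul_one, inner_smul_right, hwn, Real.norm_eq_abs,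
      abs_of_nonneg (by positivity)]
    nlinarith [h23]
  have h0 : 0 ≤ ‖F w - (2 * Real.sqrt (2 / 3)) • n₀‖ := norm_nonneg _
  nlinarith [hsq, h0]

/-- The basal mirror of an out-of-plane slot is not a slot. -/
theorem basalMirror_not_mem_fccSlots_of_ne {t : EuclideanSpace ℝ (Fin 3)} (ht : t ∈ fccSlots) (ht2 : t 2 ≠ 0) :
    basalMirror t ∉ fccSlots := by
  rcases slot_apply_two_cases ht with h | h | h
  · exact absurd h ht2
  · exact basalMirror_not_mem_fccSlots ht h
  · intro hM
    have hnt : -t ∈ fccSlots := neg_mem_fccSlots ht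
    have hnt2 : (-t) 2 = Real.sqrt (2 / 3) := by rw [PiLp.neg_apply, h, neg_neg]
    exact basalMirror_not_mem_fccSlots hnt hnt2 (by rw [map_neg]; exact neg_mem_fccSlots hM)

/-! ### The twelve known contacts of a certified predecessor -/

/-- **The contacts a strong certificate guarantees.**  `WalkCertified12 X y ⟨F, v, 0⟩` (`v` a slot): the predecessor `p = y − F v` has a `12`-element set
of contacts each of which is an `F`-slot point `p + F w` or a lowered positive slot `p + F w − 2√(2/3)·n₀` for a unit menu normal `n₀` with
`⟪F v, n₀⟫ = √(2/3)` and `⟪F w, n₀⟫ = √(2/3)`. -/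
theorem certified12_contacts {F : EuclideanSpace ℝ (Fin 3) ≃ₗᵢ[ℝ] EuclideanSpace ℝ (Fin 3)} {v y : EuclideanSpace ℝ (Fin 3)}
    (hv : v ∈ fccSlots) (h : WalkCertified12 X y ⟨F, v, 0⟩) :
    ∃ C : Finset (EuclideanSpace ℝ (Fin 3)), C ⊆ X.filter (fun q => dist (y - F v) q = 1) ∧ C.card = 12 ∧
      ∀ q ∈ C, (∃ w ∈ fccSlots, q = y - F v + F w) ∨
        ∃ (n₀ w : EuclideanSpace ℝ (Fin 3)), ‖n₀‖ = 1 ∧ ⟪F v, n₀⟫_ℝ = Real.sqrt (2 / 3) ∧ w ∈ fccSlots ∧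
          ⟪F w, n₀⟫_ℝ = Real.sqrt (2 / 3) ∧ q = y - F v + F w - (2 * Real.sqrt (2 / 3)) • n₀ := by
  classical
  set p := y - F v with hp
  have hinj : Function.Injective fun w : EuclideanSpace ℝ (Fin 3) => p + F w := fun a b hab => by
    simpa using hab
  have hdist : ∀ w ∈ fccSlots, dist p (p + F w) = 1 := fun w hw => by
    rw [dist_eq_norm, sub_add_cancel_left, norm_neg, LinearIsometryEquiv.norm_map, norm_eq_one_of_mem_fccSlots hw]
  have h' : (y - F v ∈ X ∧ ∀ w ∈ fccSlots, y - F v + F w ∈ X) ∨ ∃ n₀, CapCertified X F y v n₀ := h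
  rcases h' with ⟨-, hfull⟩ | ⟨n₀, hn, hmenu, hpos, -, hocc, hcap⟩
  · -- full predecessor: the twelve `F`-slot points
    refine ⟨fccSlots.image fun w => p + F w, fun q hq => ?_, by rw [card_image_of_injective _ hinj, card_fccSlots], fun q hq => ?_⟩
    · obtain ⟨w, hw, rfl⟩ := mem_image.1 hq
      exact mem_filter.2 ⟨hfull w hw, hdist w hw⟩
    · obtain ⟨w, hw, rfl⟩ := mem_image.1 hq
      exact Or.inl ⟨w, hw, rfl⟩
  · -- cap predecessor: nine non-negative slots and three lowered positive slots
    have hr : 0 < Real.sqrt (2 / 3) := Real.sqrt_pos.2 (by norm_num)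
    have hvn : ⟪F v, n₀⟫_ℝ = Real.sqrt (2 / 3) := by
      rcases hmenu v hv with h0 | h0 | h0
      · rw [h0] at hpos; exact absurd hpos (lt_irrefl _)
      · exact h0
      · rw [h0] at hpos; linarith
    have hposval : ∀ w ∈ fccSlots, 0 < ⟪F w, n₀⟫_ℝ → ⟪F w, n₀⟫_ℝ = Real.sqrt (2 / 3) := by
      intro w hw hw0
      rcases hmenu w hw with h0 | h0 | h0
      · rw [h0] at hw0; exact absurd hw0 (lt_irrefl _)
      · exact h0
      · rw [h0] at hw0; linarith
    set Pnn := fccSlots.filter fun w => 0 ≤ ⟪F w, n₀⟫_ℝ with hPnn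
    set Ppos := fccSlots.filter fun w => 0 < ⟪F w, n₀⟫_ℝ with hPpos
    have hPpos3 : Ppos.card = 3 := card_far_slots_eq_three F hn hmenu
    have hneg3 : (fccSlots.filter fun w => ¬ 0 ≤ ⟪F w, n₀⟫_ℝ).card = 3 := by
      have hmenu' : ∀ w ∈ fccSlots, ⟪F w, -n₀⟫_ℝ = 0 ∨ ⟪F w, -n₀⟫_ℝ = Real.sqrt (2 / 3) ∨ ⟪F w, -n₀⟫_ℝ = -Real.sqrt (2 / 3) := by
        intro w hw; rw [inner_neg_right]
        rcases hmenu w hw with h0 | h0 | h0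
        · left; rw [h0, neg_zero]
        · right; right; rw [h0]
        · right; left; rw [h0, neg_neg]
      have h3 := card_far_slots_eq_three F (by rw [norm_neg, hn]) hmenu'
      have hfilt : (fccSlots.filter fun w => ¬ 0 ≤ ⟪F w, n₀⟫_ℝ) = fccSlots.filter fun w => 0 < ⟪F w, -n₀⟫_ℝ := by
        refine filter_congr fun w _ => ?_
        rw [inner_neg_right, not_le]; constructor <;> intro hh <;> linarith
      rw [hfilt]; exact h3
    have hPnn9 : Pnn.card = 9 := by
      have := Finset.card_filter_add_card_filter_not (s := fccSlots) (fun w => 0 ≤ ⟪F w, n₀⟫_ℝ)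
      rw [hneg3, card_fccSlots] at this
      rw [hPnn]; omega
    have hinj' : Function.Injective fun w : EuclideanSpace ℝ (Fin 3) => p + F w - (2 * Real.sqrt (2 / 3)) • n₀ := fun a b hab => by
      simpa using hab
    set C := Pnn.image (fun w => p + F w) ∪ Ppos.image (fun w => p + F w - (2 * Real.sqrt (2 / 3)) • n₀) with hC
    have hdisj : Disjoint (Pnn.image fun w => p + F w) (Ppos.image fun w => p + F w - (2 * Real.sqrt (2 / 3)) • n₀) := by
      rw [disjoint_left]
      intro q hq hq'
      obtain ⟨w, hw, rfl⟩ := mem_image.1 hq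
      obtain ⟨w', hw', heq⟩ := mem_image.1 hq'
      obtain ⟨hw'm, hw'0⟩ := mem_filter.1 hw'
      obtain ⟨-, hw0⟩ := mem_filter.1 hw
      have hFw : F w = F w' - (2 * Real.sqrt (2 / 3)) • n₀ := by
        have := heq.symm; rw [add_sub_assoc] at this; exact add_left_cancel this
      have : ⟪F w, n₀⟫_ℝ = Real.sqrt (2 / 3) - 2 * Real.sqrt (2 / 3) := by
        rw [hFw, inner_sub_left, inner_smul_left, hposval w' hw'm hw'0, real_inner_self_eq_norm_sq, hn]; simp
      linarith
    refine ⟨C, fun q hq => ?_, ?_, fun q hq => ?_⟩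
    · rcases mem_union.1 hq with hq | hq
      · obtain ⟨w, hw, rfl⟩ := mem_image.1 hq
        obtain ⟨hwm, hw0⟩ := mem_filter.1 hw
        exact mem_filter.2 ⟨hocc w hwm hw0, hdist w hwm⟩
      · obtain ⟨w, hw, rfl⟩ := mem_image.1 hq
        obtain ⟨hwm, hw0⟩ := mem_filter.1 hw
        refine mem_filter.2 ⟨hcap w hwm hw0, ?_⟩
        rw [dist_eq_norm, show p - (p + F w - (2 * Real.sqrt (2 / 3)) • n₀) = -(F w - (2 * Real.sqrt (2 / 3)) • n₀) by abel,
          norm_neg, norm_sub_capShift F hwm hn (hposval w hwm hw0)]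
    · rw [hC, card_union_of_disjoint hdisj, card_image_of_injective _ hinj, card_image_of_injective _ hinj', hPnn9, hPpos3]
    · rcases mem_union.1 hq with hq | hq
      · obtain ⟨w, hw, rfl⟩ := mem_image.1 hq
        exact Or.inl ⟨w, (mem_filter.1 hw).1, rfl⟩
      · obtain ⟨w, hw, rfl⟩ := mem_image.1 hq
        obtain ⟨hwm, hw0⟩ := mem_filter.1 hw
        exact Or.inr ⟨n₀, w, hn, hvn, hwm, hposval w hwm hw0, rfl⟩

/-- **A certificate always shows an OUT-OF-PLANE slot contact**: under `WalkCertified12 X y ⟨F, v, 0⟩` some `p + F t` with `t` a slot, `t₂ ≠ 0`,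
is a ball (`p = y − F v`). -/
theorem exists_outOfPlane_contact {F : EuclideanSpace ℝ (Fin 3) ≃ₗᵢ[ℝ] EuclideanSpace ℝ (Fin 3)} {v y : EuclideanSpace ℝ (Fin 3)}
    (h : WalkCertified12 X y ⟨F, v, 0⟩) : ∃ t ∈ fccSlots, t 2 ≠ 0 ∧ y - F v + F t ∈ X := by
  have hr : 0 < Real.sqrt (2 / 3) := Real.sqrt_pos.2 (by norm_num)
  set t₀ : EuclideanSpace ℝ (Fin 3) := barlowPos 1 (Real.sqrt (2 / 3)) constHagg 1 0 0 with ht₀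
  have ht₀m : t₀ ∈ fccSlots := barlowPos_mem_fccSlots (by simp [fccSlotTriples] : ((1:ℤ), (0:ℤ), (0:ℤ)) ∈ fccSlotTriples)
  have ht₀2 : t₀ 2 = Real.sqrt (2 / 3) := by rw [ht₀, barlowPos_apply_two]; simp
  have ht₀2' : t₀ 2 ≠ 0 := by rw [ht₀2]; exact hr.ne'
  have hnt₀2' : (-t₀) 2 ≠ 0 := by rw [PiLp.neg_apply, ht₀2]; linarith
  have h' : (y - F v ∈ X ∧ ∀ w ∈ fccSlots, y - F v + F w ∈ X) ∨ ∃ n₀, CapCertified X F y v n₀ := h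
  rcases h' with ⟨-, hfull⟩ | ⟨n₀, -, -, -, -, hocc, -⟩
  · exact ⟨t₀, ht₀m, ht₀2', hfull t₀ ht₀m⟩
  · by_cases hs : 0 ≤ ⟪F t₀, n₀⟫_ℝ
    · exact ⟨t₀, ht₀m, ht₀2', hocc t₀ ht₀m hs⟩
    · refine ⟨-t₀, neg_mem_fccSlots ht₀m, hnt₀2', hocc (-t₀) (neg_mem_fccSlots ht₀m) ?_⟩
      rw [map_neg, inner_neg_left]; linarith

/-! ### The clash -/

/-- **TWIN BOTTOMS CLASH.**  In a `1`-separated `X`, the bottom states `⟨A, u, 0⟩` and `⟨twinFrame A (A e₃), u, 0⟩` (`u` an in-plane slot) are not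
both strongly certified at one ball. -/
theorem not_both_certified12_twinBottoms (hX : ∀ p ∈ X, ∀ q ∈ X, p ≠ q → 1 ≤ dist p q)
    {A : EuclideanSpace ℝ (Fin 3) ≃ₗᵢ[ℝ] EuclideanSpace ℝ (Fin 3)} {u : EuclideanSpace ℝ (Fin 3)} (hu : u ∈ fccSlots) (hu2 : u 2 = 0)
    {y : EuclideanSpace ℝ (Fin 3)} (h₁ : WalkCertified12 X y ⟨A, u, 0⟩)
    (h₂ : WalkCertified12 X y ⟨twinFrame A (A (EuclideanSpace.single (2 : Fin 3) (1 : ℝ))), u, 0⟩) : False := by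
  classical
  set G := twinFrame A (A (EuclideanSpace.single (2 : Fin 3) (1 : ℝ))) with hGdef
  have hG : ∀ x, G x = A (basalMirror x) := twinFrame_axis_apply A
  have hGu : G u = A u := by rw [hG, basalMirror_of_inPlane hu2]
  have hr : 0 < Real.sqrt (2 / 3) := Real.sqrt_pos.2 (by norm_num)
  have h23 : Real.sqrt (2 / 3) * Real.sqrt (2 / 3) = 2 / 3 := Real.mul_self_sqrt (by norm_num)
  set p := y - A u with hp
  -- the twelve known contacts of `p` from the `A`-certificate fill the contact set
  obtain ⟨C, hCsub, hCcard, hCform⟩ := certified12_contacts hu h₁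
  have hN12 := card_filter_dist_eq_one_le_twelve X hX (y - A u)
  have hCN : C = X.filter (fun q => dist (y - A u) q = 1) := eq_of_subset_of_card_le hCsub (by rw [hCcard]; exact hN12)
  -- the out-of-plane `G`-slot contact from the `G`-certificate
  obtain ⟨t, ht, ht2, htX⟩ := exists_outOfPlane_contact h₂
  have hGu' : y - G u = p := by rw [hGu]
  rw [hGu', hG] at htX
  have hq : p + A (basalMirror t) ∈ C := by
    rw [hCN, mem_filter]
    refine ⟨htX, ?_⟩
    rw [dist_eq_norm, ← hp, sub_add_cancel_left, norm_neg, LinearIsometryEquiv.norm_map, LinearIsometryEquiv.norm_map,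
      norm_eq_one_of_mem_fccSlots ht]
  rcases hCform _ hq with ⟨w, hw, heq⟩ | ⟨n₀, w, hn, hun, hw, hwn, heq⟩
  · -- an `A`-slot point: `basalMirror t` would be a slot
    have : basalMirror t = w := A.injective (add_left_cancel (heq.trans (by rw [hp])))
    exact basalMirror_not_mem_fccSlots_of_ne ht ht2 (this ▸ hw)
  · -- a lowered positive `A`-slot: pair with the in-plane row slot `u`
    have heq' : A (basalMirror t) = A w - (2 * Real.sqrt (2 / 3)) • n₀ := by
      have := heq; rw [← hp, add_sub_assoc] at this; exact add_left_cancel this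
    have hmodel : basalMirror t = w - (2 * Real.sqrt (2 / 3)) • A.symm n₀ := by
      apply A.injective
      rw [map_sub, LinearIsometryEquiv.map_smul, LinearIsometryEquiv.apply_symm_apply]; exact heq'
    have hcu : ⟪A.symm n₀, u⟫_ℝ = Real.sqrt (2 / 3) := by
      rw [← LinearIsometryEquiv.inner_map_map A, LinearIsometryEquiv.apply_symm_apply, real_inner_comm]; exact hun
    have key : ⟪t, u⟫_ℝ = ⟪w, u⟫_ℝ - 4 / 3 := by
      have h1 : ⟪basalMirror t, u⟫_ℝ = ⟪t, u⟫_ℝ := inner_basalMirror_of_inPlane t hu2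
      rw [← h1, hmodel, inner_sub_left, inner_smul_left, hcu]
      simp only [RCLike.conj_to_real]
      nlinarith [h23]
    rcases inner_slots_mem ht hu with h0 | h0 | h0 | h0 | h0 <;>
      rcases inner_slots_mem hw hu with h1 | h1 | h1 | h1 | h1 <;> linarith

end Summit.Ventures.Crystal3D.Theorems

end
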